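import Literature.NumberTheory.CubicFields.DavenportBoundPosPairs
import Literature.NumberTheory.CubicFields.DeloneFaddeevIrreducible
import HarnessLib

/-!
# Davenport's bound `O(X)` for classes of binary cubic forms of positive discriminant

`Proofs` file (theorems only), topic `Literature/NumberTheory/CubicFields`, completing
`HessianReduction.lean`, `DavenportBoundPosFibers.lean`, `DavenportBoundPosPairs.lean`:
**the number of `GL₂(ℤ)`-orbits of irreducible integral binary cubic forms with `0 < Disc < X` is
`O(X)`** (`ncard_gl2zOrbits_pos_le`; Davenport 1951: `= (π²/72)·X + O(X^{15/16})` for the properly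
primitive classes — only the order of magnitude is formalized).  Every such orbit contains a
Hessian-reduced form (`exists_gl2zEquiv_hessianReduced`) with `a ≠ 0` (irreducibility); for fixed
`a` there are `≤ 200√X` admissible `(b, c)` (`ncard_bcPairs_le`) and for fixed `(a, b, c)` at most
`X^{2/5}|a|^{-3/5} + 2` admissible `d` (`ncard_dFibre_le`); finally `|a| ≤ X^{1/4}` and
`Σ_{n ≤ A} n^{-3/5} ≤ (5/2)A^{2/5}` (`sum_inv_cube_fifthRoot_le`).

## References

* H. Davenport, *On the class-number of binary cubic forms I*, J. London Math. Soc. 26 (1951)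
  183–192, Theorem [Davenport1951CubicFormsI].
* K. Belabas, *A fast algorithm to compute cubic fields*, Math. Comp. 66 (1997), §5 [Belabas1997].
* K. Belabas, M. Bhargava, C. Pomerance, *Error estimates for the Davenport–Heilbronn theorems*,
  Duke Math. J. 153 (2010), Lemma 2.2 (`q = 1`) [BelabasBhargavaPomerance2010].
-/

noncomputable section

namespace Literature.NumberTheory.CubicFields

namespace BinaryCubic

open Finset

/-! ### `Σ n^{-3/5}` -/

/-- `3u⁵ − 5u³v² + 2v⁵ = (u − v)²(3u³ + 6u²v + 4uv² + 2v³) ≥ 0` for `0 ≤ v ≤ u`. [folklore] -/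
theorem key_quintic_ineq {u v : ℝ} (hu : 0 ≤ u) (hv : 0 ≤ v) :
    0 ≤ 3 * u ^ 5 - 5 * u ^ 3 * v ^ 2 + 2 * v ^ 5 := by
  have : 3 * u ^ 5 - 5 * u ^ 3 * v ^ 2 + 2 * v ^ 5 =
      (u - v) ^ 2 * (3 * u ^ 3 + 6 * u ^ 2 * v + 4 * u * v ^ 2 + 2 * v ^ 3) := by ring
  rw [this]; positivity

/-- **`Σ_{n=1}^{N} n^{-3/5} ≤ (5/2) N^{2/5}`**, written with fifth roots `β(n)⁵ = n`:
`Σ_{n<N} β(n+1)⁻³ ≤ (5/2) β(N)²`. [folklore] -/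
theorem sum_inv_cube_fifthRoot_le (N : ℕ) :
    ∑ n ∈ Finset.range N, ((((n + 1 : ℕ) : ℝ) ^ ((5 : ℕ) : ℝ)⁻¹) ^ 3)⁻¹ ≤
      5 / 2 * (((N : ℕ) : ℝ) ^ ((5 : ℕ) : ℝ)⁻¹) ^ 2 := by
  induction N with
  | zero => simp
  | succ N ih =>
    rw [Finset.sum_range_succ]
    set u : ℝ := (((N + 1 : ℕ) : ℝ) ^ ((5 : ℕ) : ℝ)⁻¹) with hu
    set v : ℝ := (((N : ℕ) : ℝ) ^ ((5 : ℕ) : ℝ)⁻¹) with hv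
    have hu5 : u ^ 5 = (N + 1 : ℕ) := Real.rpow_inv_natCast_pow (by positivity) (by norm_num)
    have hv5 : v ^ 5 = (N : ℕ) := Real.rpow_inv_natCast_pow (by positivity) (by norm_num)
    have hu0 : 0 < u := Real.rpow_pos_of_pos (by positivity) _
    have hv0 : 0 ≤ v := Real.rpow_nonneg (by positivity) _
    have huv : u ^ 5 - v ^ 5 = 1 := by rw [hu5, hv5]; push_cast; ring
    have hvu : v ≤ u := by
      have : v ^ 5 ≤ u ^ 5 := by linarith
      exact le_of_pow_le_pow_left₀ (by norm_num) hu0.le this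
    -- `1/u³ ≤ (5/2)(u² − v²)`
    have hkey : (u ^ 3)⁻¹ ≤ 5 / 2 * (u ^ 2 - v ^ 2) := by
      rw [inv_eq_one_div, div_le_iff₀ (by positivity)]
      nlinarith [key_quintic_ineq hu0.le hv0, pow_pos hu0 3]
    linarith

/-! ### The reduced quadruples -/

/-- The set of `((b, c), d)` completing `a ≠ 0` to a Hessian-reduced form with `0 < Disc < X` is finite.
[folklore] -/
theorem redTriples_finite {a : ℤ} (ha : a ≠ 0) (X : ℕ) :
    {x : (ℤ × ℤ) × ℤ | 0 < (BinaryCubic.mk a x.1.1 x.1.2 x.2).hessP ∧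
        |(BinaryCubic.mk a x.1.1 x.1.2 x.2).hessQ| ≤ (BinaryCubic.mk a x.1.1 x.1.2 x.2).hessP ∧
        (BinaryCubic.mk a x.1.1 x.1.2 x.2).hessP ≤ (BinaryCubic.mk a x.1.1 x.1.2 x.2).hessR ∧
        0 < (BinaryCubic.mk a x.1.1 x.1.2 x.2).disc ∧ (BinaryCubic.mk a x.1.1 x.1.2 x.2).disc < X}.Finite := by
  refine (((bcPairs_finite ha X).biUnion fun p _ =>
    ((finite_d_disc_pos ha p.1 p.2).image (Prod.mk p)))).subset ?_
  rintro ⟨p, d⟩ ⟨hP, hQ, hR, hD, hDX⟩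
  rw [Set.mem_iUnion₂]
  exact ⟨p, ⟨d, hP, hQ, hR, hD, hDX⟩, ⟨d, hD, rfl⟩⟩

/-- **For fixed `a ≠ 0`, at most `200√X · (X^{2/5}|a|^{-3/5} + 2)` triples `(b, c, d)`** complete `a`
to a Hessian-reduced form with `0 < Disc < X` (with `y⁵ = X`, `β⁵ = |a|`).
[cite: Davenport1951CubicFormsI, §3] -/
theorem ncard_redTriples_le {a : ℤ} (ha : a ≠ 0) (X : ℕ) (hX : 1 ≤ X) {y β : ℝ} (hy : 0 < y)
    (hyX : y ^ 5 = X) (hβ : 0 < β) (hβa : β ^ 5 = |(a : ℝ)|) :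
    ((Set.ncard {x : (ℤ × ℤ) × ℤ | 0 < (BinaryCubic.mk a x.1.1 x.1.2 x.2).hessP ∧
        |(BinaryCubic.mk a x.1.1 x.1.2 x.2).hessQ| ≤ (BinaryCubic.mk a x.1.1 x.1.2 x.2).hessP ∧
        (BinaryCubic.mk a x.1.1 x.1.2 x.2).hessP ≤ (BinaryCubic.mk a x.1.1 x.1.2 x.2).hessR ∧
        0 < (BinaryCubic.mk a x.1.1 x.1.2 x.2).disc ∧ (BinaryCubic.mk a x.1.1 x.1.2 x.2).disc < X} : ℕ) : ℝ) ≤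
      200 * Real.sqrt X * (y ^ 2 / β ^ 3 + 2) := by
  classical
  set T := {x : (ℤ × ℤ) × ℤ | 0 < (BinaryCubic.mk a x.1.1 x.1.2 x.2).hessP ∧
        |(BinaryCubic.mk a x.1.1 x.1.2 x.2).hessQ| ≤ (BinaryCubic.mk a x.1.1 x.1.2 x.2).hessP ∧
        (BinaryCubic.mk a x.1.1 x.1.2 x.2).hessP ≤ (BinaryCubic.mk a x.1.1 x.1.2 x.2).hessR ∧
        0 < (BinaryCubic.mk a x.1.1 x.1.2 x.2).disc ∧ (BinaryCubic.mk a x.1.1 x.1.2 x.2).disc < X} with hTdef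
  have hpf := bcPairs_finite ha X
  set B : Finset (ℤ × ℤ) := hpf.toFinset with hBdef
  have hB : ∀ x ∈ T, x.1 ∈ B := by
    rintro ⟨p, d⟩ ⟨hP, hQ, hR, hD, hDX⟩
    rw [hBdef, Set.Finite.mem_toFinset]
    exact ⟨d, hP, hQ, hR, hD, hDX⟩
  have hfin : ∀ p ∈ B, {d : ℤ | (p, d) ∈ T}.Finite := fun p _ =>
    (finite_d_disc_pos ha p.1 p.2).subset fun d hd => hd.2.2.2.1
  have hfib := ncard_le_sum_ncard_fibre T B hB hfin
  simp only [hTdef, Set.mem_setOf_eq] at hfib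
  have hcard : (B.card : ℝ) ≤ 200 * Real.sqrt X := by
    rw [hBdef, ← Set.ncard_eq_toFinset_card _ hpf]; exact ncard_bcPairs_le ha X hX
  calc (T.ncard : ℝ) ≤ _ := hfib
    _ ≤ ∑ p ∈ B, (y ^ 2 / β ^ 3 + 2) :=
        Finset.sum_le_sum fun p _ => ncard_dFibre_le ha p.1 p.2 X hy hyX hβ hβa
    _ = B.card * (y ^ 2 / β ^ 3 + 2) := by rw [Finset.sum_const, nsmul_eq_mul]
    _ ≤ 200 * Real.sqrt X * (y ^ 2 / β ^ 3 + 2) := by gcongr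

/-! ### The orbit count -/

/-- **Davenport's bound (order of magnitude): the number of `GL₂(ℤ)`-orbits of irreducible integral
binary cubic forms with `0 < Disc < X` is at most `2000·X`.** Every orbit contains a Hessian-reduced
form `(a, b, c, d)` with `a ≠ 0`, `|a| ≤ X^{1/4}`; sum `ncard_redTriples_le` over `a` with
`Σ_{n≤A} n^{-3/5} ≤ (5/2)A^{2/5}`. [cite: Davenport1951CubicFormsI, Theorem]
[cite: BelabasBhargavaPomerance2010, Lemma 2.2] -/
theorem ncard_gl2zOrbits_pos_le (X : ℕ) :
    (({O : Set (BinaryCubic ℤ) | ∃ f : BinaryCubic ℤ, O = gl2zOrbit f ∧ f.IsIrreducible ∧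
        0 < f.disc ∧ f.disc < X}.ncard : ℕ) : ℝ) ≤ 2000 * X := by
  classical
  rcases Nat.eq_zero_or_pos X with hX0 | hXpos
  · -- no discriminant in `(0, 0)`
    subst hX0
    have : {O : Set (BinaryCubic ℤ) | ∃ f : BinaryCubic ℤ, O = gl2zOrbit f ∧ f.IsIrreducible ∧
        0 < f.disc ∧ f.disc < ((0 : ℕ) : ℤ)} = ∅ := by
      ext O
      simp only [Set.mem_setOf_eq, Set.mem_empty_iff_false, iff_false, not_exists, not_and]
      intro f _ _ h1 h2
      push_cast at h2
      omega
    rw [this, Set.ncard_empty]; simp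
  have hX : 1 ≤ X := hXpos
  have hX1 : (1 : ℝ) ≤ X := by exact_mod_cast hX
  -- the reduced quadruples `(a, ((b, c), d))`
  set Rq : Set (ℤ × ((ℤ × ℤ) × ℤ)) := {z | z.1 ≠ 0 ∧ (0 < (BinaryCubic.mk z.1 z.2.1.1 z.2.1.2 z.2.2).hessP ∧
        |(BinaryCubic.mk z.1 z.2.1.1 z.2.1.2 z.2.2).hessQ| ≤ (BinaryCubic.mk z.1 z.2.1.1 z.2.1.2 z.2.2).hessP ∧
        (BinaryCubic.mk z.1 z.2.1.1 z.2.1.2 z.2.2).hessP ≤ (BinaryCubic.mk z.1 z.2.1.1 z.2.1.2 z.2.2).hessR ∧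
        0 < (BinaryCubic.mk z.1 z.2.1.1 z.2.1.2 z.2.2).disc ∧ (BinaryCubic.mk z.1 z.2.1.1 z.2.1.2 z.2.2).disc < X)}
    with hRq
  -- real parameters
  set r : ℝ := Real.sqrt X with hr
  have hr1 : 1 ≤ r := by rw [hr]; exact Real.one_le_sqrt.mpr hX1
  have hr2 : r ^ 2 = X := Real.sq_sqrt (by positivity)
  set q : ℝ := Real.sqrt r with hq
  have hq1 : 1 ≤ q := by rw [hq]; exact Real.one_le_sqrt.mpr hr1
  have hq2 : q ^ 2 = r := Real.sq_sqrt (by positivity)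
  set y : ℝ := (X : ℝ) ^ ((5 : ℕ) : ℝ)⁻¹ with hydef
  have hy0 : 0 < y := Real.rpow_pos_of_pos (by positivity) _
  have hy5 : y ^ 5 = X := Real.rpow_inv_natCast_pow (by positivity) (by norm_num)
  -- the `a`-range: `|a| ≤ A = ⌊q⌋`
  set A : ℕ := ⌊q⌋₊ with hA
  have hAq : (A : ℝ) ≤ q := Nat.floor_le (by positivity)
  have hmemA : ∀ z ∈ Rq, z.1 ∈ (Finset.Icc (-(A : ℤ)) A) := by
    rintro ⟨a, ⟨⟨b, c⟩, d⟩⟩ ⟨ha, hP, hQ, hR, hD, hDX⟩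
    obtain ⟨hP0, h27, hPX, -, -⟩ := reduced_facts ha hP hQ hR hD hDX
    have h1 : ((b : ℝ) ^ 2 - 3 * a * c) < r := by
      have : ((b : ℝ) ^ 2 - 3 * a * c) ^ 2 < r ^ 2 := by rw [hr2]; exact hPX
      exact lt_of_pow_lt_pow_left₀ 2 (by positivity) this
    have h2 : |(a : ℝ)| < q := by
      have : |(a : ℝ)| ^ 2 < q ^ 2 := by rw [hq2]; nlinarith
      exact lt_of_pow_lt_pow_left₀ 2 (by positivity) this
    have h3 : a.natAbs ≤ A := by
      rw [hA]; apply Nat.le_floor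
      have h4 : (a.natAbs : ℝ) = |(a : ℝ)| := by rw [Nat.cast_natAbs, Int.cast_abs]
      rw [h4]; exact h2.le
    rw [Finset.mem_Icc]
    omega
  -- orbits inject into the image of the reduced quadruples
  have horb : {O : Set (BinaryCubic ℤ) | ∃ f : BinaryCubic ℤ, O = gl2zOrbit f ∧ f.IsIrreducible ∧
        0 < f.disc ∧ f.disc < X} ⊆
      (fun z : ℤ × ((ℤ × ℤ) × ℤ) => gl2zOrbit (BinaryCubic.mk z.1 z.2.1.1 z.2.1.2 z.2.2)) '' Rq := by
    rintro O ⟨f, rfl, hirr, hD, hDX⟩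
    obtain ⟨g, hfg, hQ, hR⟩ := exists_gl2zEquiv_hessianReduced f hD
    have hgirr : g.IsIrreducible := hfg.isIrreducible_iff.mp hirr
    have hga : g.a ≠ 0 := hgirr.1
    have hgD : g.disc = f.disc := hfg.disc_eq
    have hP : 0 < g.hessP := by
      rcases (abs_nonneg g.hessQ).trans hQ |>.lt_or_eq with h | h
      · exact h
      · exfalso
        have hQ0 : g.hessQ = 0 := by
          have : |g.hessQ| ≤ 0 := h ▸ hQ
          exact abs_nonpos_iff.mp this
        have := g.hessQ_sq_sub_four_mul
        rw [hQ0, ← h] at this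
        have : f.disc = 0 := by rw [← hgD]; linarith
        linarith
    refine ⟨(g.a, ((g.b, g.c), g.d)), ⟨hga, ?_⟩, ?_⟩
    · simp only
      exact ⟨hP, hQ, hR, hgD ▸ hD, hgD ▸ hDX⟩
    · simp only
      exact (gl2zOrbit_eq_iff.mpr hfg).symm
  -- `Rq` is finite and counted by fibres over `a`
  have hfinA : ∀ a ∈ Finset.Icc (-(A : ℤ)) A, {x : (ℤ × ℤ) × ℤ | (a, x) ∈ Rq}.Finite := by
    intro a _
    by_cases ha : a = 0
    · convert Set.finite_empty
      ext x
      simp [hRq, ha]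
    · exact (redTriples_finite ha X).subset fun x hx => hx.2
  have hfib := ncard_le_sum_ncard_fibre Rq (Finset.Icc (-(A : ℤ)) A) hmemA hfinA
  have hRqfin : Rq.Finite := by
    refine (((Finset.Icc (-(A : ℤ)) A).finite_toSet).biUnion fun a ha => ((hfinA a ha).image (Prod.mk a))).subset ?_
    intro z hz
    rw [Set.mem_iUnion₂]
    exact ⟨z.1, hmemA z hz, ⟨z.2, hz, rfl⟩⟩
  -- per-`a` bound
  have hpera : ∀ a ∈ Finset.Icc (-(A : ℤ)) A, (({x : (ℤ × ℤ) × ℤ | (a, x) ∈ Rq}).ncard : ℝ) ≤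
      if a = 0 then 0 else 200 * r * (y ^ 2 / (((a.natAbs : ℕ) : ℝ) ^ ((5 : ℕ) : ℝ)⁻¹) ^ 3 + 2) := by
    intro a _
    by_cases ha : a = 0
    · rw [if_pos ha]
      have : {x : (ℤ × ℤ) × ℤ | (a, x) ∈ Rq} = ∅ := by
        ext x; simp [hRq, ha]
      rw [this, Set.ncard_empty]; simp
    · rw [if_neg ha]
      set β : ℝ := ((a.natAbs : ℕ) : ℝ) ^ ((5 : ℕ) : ℝ)⁻¹ with hβdef
      have hna : (0 : ℝ) < (a.natAbs : ℕ) := by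
        have : 0 < a.natAbs := Int.natAbs_pos.mpr ha
        exact_mod_cast this
      have hβ0 : 0 < β := Real.rpow_pos_of_pos hna _
      have hβ5 : β ^ 5 = |(a : ℝ)| := by
        rw [hβdef, Real.rpow_inv_natCast_pow hna.le (by norm_num), Nat.cast_natAbs, Int.cast_abs]
      have hset : {x : (ℤ × ℤ) × ℤ | (a, x) ∈ Rq} = {x : (ℤ × ℤ) × ℤ | 0 < (BinaryCubic.mk a x.1.1 x.1.2 x.2).hessP ∧
        |(BinaryCubic.mk a x.1.1 x.1.2 x.2).hessQ| ≤ (BinaryCubic.mk a x.1.1 x.1.2 x.2).hessP ∧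
        (BinaryCubic.mk a x.1.1 x.1.2 x.2).hessP ≤ (BinaryCubic.mk a x.1.1 x.1.2 x.2).hessR ∧
        0 < (BinaryCubic.mk a x.1.1 x.1.2 x.2).disc ∧ (BinaryCubic.mk a x.1.1 x.1.2 x.2).disc < X} := by
        ext x; simp [hRq, ha]
      rw [hset]
      exact ncard_redTriples_le ha X hX hy0 hy5 hβ0 hβ5
  -- summing over `a`
  have hsumβ : ∑ a ∈ Finset.Icc (-(A : ℤ)) A,
      (if a = 0 then (0 : ℝ) else 200 * r * (y ^ 2 / (((a.natAbs : ℕ) : ℝ) ^ ((5 : ℕ) : ℝ)⁻¹) ^ 3 + 2)) ≤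
      2 * (200 * r * (y ^ 2 * (5 / 2 * (((A : ℕ) : ℝ) ^ ((5 : ℕ) : ℝ)⁻¹) ^ 2) + 2 * A)) := by
    -- split `a < 0`, `a = 0`, `a > 0` via the images of `range A`
    set φ : ℕ → ℝ := fun n => 200 * r * (y ^ 2 / ((((n : ℕ) : ℝ) ^ ((5 : ℕ) : ℝ)⁻¹) ^ 3) + 2) with hφ
    have hφ0 : ∀ n, 0 ≤ φ n := fun n => by rw [hφ]; positivity
    have hterm : ∀ a ∈ Finset.Icc (-(A : ℤ)) A,
        (if a = 0 then (0 : ℝ) else 200 * r * (y ^ 2 / (((a.natAbs : ℕ) : ℝ) ^ ((5 : ℕ) : ℝ)⁻¹) ^ 3 + 2)) ≤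
        (if 0 < a then φ a.natAbs else 0) + (if a < 0 then φ a.natAbs else 0) := by
      intro a _
      rcases lt_trichotomy a 0 with h | h | h
      · rw [if_neg h.ne, if_neg (by omega), if_pos h]; simp [hφ]
      · subst h; simp
      · rw [if_neg h.ne', if_pos h, if_neg (by omega)]; simp [hφ]
    have hpos : ∑ a ∈ Finset.Icc (-(A : ℤ)) A, (if 0 < a then φ a.natAbs else 0) ≤
        ∑ n ∈ Finset.range A, φ (n + 1) := by
      rw [← Finset.sum_filter]
      have hsub : (Finset.Icc (-(A : ℤ)) A).filter (fun a => 0 < a) ⊆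
          (Finset.range A).image (fun n : ℕ => ((n : ℤ) + 1)) := by
        intro a ha
        rw [Finset.mem_filter, Finset.mem_Icc] at ha
        rw [Finset.mem_image]
        refine ⟨(a - 1).toNat, ?_, ?_⟩
        · rw [Finset.mem_range]; omega
        · omega
      have hinj : Set.InjOn (fun n : ℕ => ((n : ℤ) + 1)) ↑(Finset.range A) := by
        intro i _ j _ h; simpa using h
      calc ∑ a ∈ (Finset.Icc (-(A : ℤ)) A).filter (fun a => 0 < a), φ a.natAbs
          ≤ ∑ a ∈ (Finset.range A).image (fun n : ℕ => ((n : ℤ) + 1)), φ a.natAbs :=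
            Finset.sum_le_sum_of_subset_of_nonneg hsub fun a _ _ => hφ0 _
        _ = ∑ n ∈ Finset.range A, φ ((n : ℤ) + 1).natAbs := Finset.sum_image hinj
        _ = ∑ n ∈ Finset.range A, φ (n + 1) := by
            refine Finset.sum_congr rfl fun n _ => ?_
            rw [show ((n : ℤ) + 1).natAbs = n + 1 by omega]
    have hneg : ∑ a ∈ Finset.Icc (-(A : ℤ)) A, (if a < 0 then φ a.natAbs else 0) ≤
        ∑ n ∈ Finset.range A, φ (n + 1) := by
      rw [← Finset.sum_filter]
      have hsub : (Finset.Icc (-(A : ℤ)) A).filter (fun a => a < 0) ⊆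
          (Finset.range A).image (fun n : ℕ => -((n : ℤ) + 1)) := by
        intro a ha
        rw [Finset.mem_filter, Finset.mem_Icc] at ha
        rw [Finset.mem_image]
        refine ⟨(-a - 1).toNat, ?_, ?_⟩
        · rw [Finset.mem_range]; omega
        · omega
      have hinj : Set.InjOn (fun n : ℕ => -((n : ℤ) + 1)) ↑(Finset.range A) := by
        intro i _ j _ h
        have : (i : ℤ) + 1 = (j : ℤ) + 1 := neg_inj.mp h
        exact_mod_cast (add_right_cancel this)
      calc ∑ a ∈ (Finset.Icc (-(A : ℤ)) A).filter (fun a => a < 0), φ a.natAbs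
          ≤ ∑ a ∈ (Finset.range A).image (fun n : ℕ => -((n : ℤ) + 1)), φ a.natAbs :=
            Finset.sum_le_sum_of_subset_of_nonneg hsub fun a _ _ => hφ0 _
        _ = ∑ n ∈ Finset.range A, φ (-((n : ℤ) + 1)).natAbs := Finset.sum_image hinj
        _ = ∑ n ∈ Finset.range A, φ (n + 1) := by
            refine Finset.sum_congr rfl fun n _ => ?_
            rw [show (-((n : ℤ) + 1)).natAbs = n + 1 by omega]
    have hφsum : ∑ n ∈ Finset.range A, φ (n + 1) ≤
        200 * r * (y ^ 2 * (5 / 2 * (((A : ℕ) : ℝ) ^ ((5 : ℕ) : ℝ)⁻¹) ^ 2) + 2 * A) := by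
      have hs := sum_inv_cube_fifthRoot_le A
      have heq : ∀ n ∈ Finset.range A, φ (n + 1) =
          200 * r * y ^ 2 * ((((n + 1 : ℕ) : ℝ) ^ ((5 : ℕ) : ℝ)⁻¹) ^ 3)⁻¹ + 400 * r := by
        intro n _
        rw [hφ]; ring
      rw [Finset.sum_congr rfl heq, Finset.sum_add_distrib, Finset.sum_const, Finset.card_range,
        ← Finset.mul_sum, nsmul_eq_mul]
      have h1 : 200 * r * y ^ 2 * ∑ n ∈ Finset.range A, ((((n + 1 : ℕ) : ℝ) ^ ((5 : ℕ) : ℝ)⁻¹) ^ 3)⁻¹ ≤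
          200 * r * y ^ 2 * (5 / 2 * (((A : ℕ) : ℝ) ^ ((5 : ℕ) : ℝ)⁻¹) ^ 2) :=
        mul_le_mul_of_nonneg_left hs (by positivity)
      nlinarith [h1]
    have hsum2 := Finset.sum_le_sum hterm
    rw [Finset.sum_add_distrib] at hsum2
    linarith [hsum2, hpos, hneg, hφsum]
  -- numerics: `y² A^{2/5} ≤ r` and `A ≤ q ≤ r`
  set βA : ℝ := ((A : ℕ) : ℝ) ^ ((5 : ℕ) : ℝ)⁻¹ with hβA
  have hβA0 : 0 ≤ βA := Real.rpow_nonneg (by positivity) _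
  have hβA5 : βA ^ 5 = A := Real.rpow_inv_natCast_pow (by positivity) (by norm_num)
  have hyβ : y ^ 2 * βA ^ 2 ≤ r := by
    have h1 : (y ^ 2 * βA ^ 2) ^ 10 ≤ r ^ 10 := by
      have e1 : (y ^ 2 * βA ^ 2) ^ 10 = (y ^ 5) ^ 4 * (βA ^ 5) ^ 4 := by ring
      have e2 : r ^ 10 = (r ^ 2) ^ 4 * (q ^ 2) ^ 2 := by rw [hq2]; ring
      rw [e1, e2, hy5, hβA5, hr2]
      gcongr
      calc ((A : ℕ) : ℝ) ^ 4 ≤ q ^ 4 := pow_le_pow_left₀ (by positivity) hAq 4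
        _ = (q ^ 2) ^ 2 := by ring
    exact le_of_pow_le_pow_left₀ (by norm_num) (by positivity) h1
  have hqr : q ≤ r := by nlinarith
  have hAr : (A : ℝ) ≤ r := hAq.trans hqr
  calc (({O : Set (BinaryCubic ℤ) | ∃ f : BinaryCubic ℤ, O = gl2zOrbit f ∧ f.IsIrreducible ∧
        0 < f.disc ∧ f.disc < X}.ncard : ℕ) : ℝ)
      ≤ (((fun z : ℤ × ((ℤ × ℤ) × ℤ) => gl2zOrbit (BinaryCubic.mk z.1 z.2.1.1 z.2.1.2 z.2.2)) '' Rq).ncard : ℝ) := by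
        exact_mod_cast Set.ncard_le_ncard horb (hRqfin.image _)
    _ ≤ (Rq.ncard : ℝ) := by exact_mod_cast Set.ncard_image_le hRqfin
    _ ≤ _ := hfib
    _ ≤ ∑ a ∈ Finset.Icc (-(A : ℤ)) A,
          (if a = 0 then (0 : ℝ) else 200 * r * (y ^ 2 / (((a.natAbs : ℕ) : ℝ) ^ ((5 : ℕ) : ℝ)⁻¹) ^ 3 + 2)) :=
        Finset.sum_le_sum hpera
    _ ≤ 2 * (200 * r * (y ^ 2 * (5 / 2 * βA ^ 2) + 2 * A)) := hsumβ
    _ = 400 * r * (5 / 2 * (y ^ 2 * βA ^ 2)) + 800 * r * A := by ring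
    _ ≤ 400 * r * (5 / 2 * r) + 800 * r * r := by gcongr
    _ = 1800 * r ^ 2 := by ring
    _ ≤ 2000 * X := by rw [hr2]; nlinarith

end BinaryCubic

end Literature.NumberTheory.CubicFields

end
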